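import Literature.Analysis.FluidPDE.Tao2016AveragedNS.PseudoOrbitReduction
import HarnessLib

/-!
# Pseudo-orbits are uniform limits of differentiable approximate trajectories (Steklov smoothing)

Cell `pub-fluidc`, blueprint seat 1 (gen 14). HONEST FRAMING: low prior, high value-of-information
experiment on Tao's machine paradigm [Tao2016AveragedNS, §5.5]; NOT a claim that NS blows up.

The cell's pseudo-orbits (`IsPseudoOrbit F δ R T Y`, CircuitShadowing.lean — the honest model of
interpolated numerical output and of the designed modes along a forced trajectory) are continuous on
`[0,T]` and only RIGHT-differentiable on `[0,T)`, with defect `‖∂ₜ⁺Y - F(Y)‖ ≤ δ`. The seed-scale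
chain SeedScaleIgnition … SeedScaleTiming (Theorem 5.3 for the retuned delay circuit along forced
trajectories) is written for DIFFERENTIABLE approximate trajectories: a velocity `V` with `∂ₜY = V`
two-sided everywhere and `‖V - F(Y)‖ ≤ δ` on `[0,T)`. This file closes the gap once and for all, for
an arbitrary continuous field `F` on `ℝ^m`:

**`IsPseudoOrbit.exists_smooth_approx`** — a globally continuous `δ`-pseudo-orbit `Y` of a continuous
field `F` on `[0,T]` (`T > 0`) with `‖Y‖ ≤ R₀` on `[0,T]` is, for every `η > 0`, within `η` on `[0,T]`
of a trajectory `Z` that is differentiable on all of `ℝ` with velocity `W`, has defect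
`‖W - F(Z)‖ ≤ δ + η` on `[0,T)` and `‖Z‖ ≤ R₀ + η` on `[0,T]`.

Construction (Steklov regularisation, [HairerNorsettWanner1993, §I.10] "approximate solutions";
folklore): extend `Y` past `T` LINEARLY along `F(Y T)` (`Yp t = Y(min t T) + (t - T)₊ • F(Y T)`, so
that the right defect stays `≤ δ + η/3` slightly beyond `T` — the constant extension would not do,
its defect near `T` is `‖F(Y T)‖`), and average over a short forward window:
`Z t = σ⁻¹ ∫ₜ^{t+σ} Yp`, `W t = σ⁻¹ (Yp(t+σ) - Yp t)`. Then `∂ₜZ = W` two-sided everywhere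
(fundamental theorem of calculus for the continuous `Yp`), `‖Z - Yp‖ ≤ osc_σ(Yp)`, and the one-sided
mean value inequality applied to `s ↦ Yp s - s • F(Yp t)` on `[t, t+σ]` gives
`‖W t - F(Yp t)‖ ≤ δ + η/3 + (modulus of F)(osc_σ Yp)`; uniform continuity of `Yp` on `[0,T+1]` and
of `F` on a compact ball fixes `σ`. Global continuity of `Y` is WLOG for the cell's question
(`pseudoOrbitTransitionSeed_of_continuous`, PseudoOrbitReduction.lean).

Use (SeedScaleClosure.lean): the conclusions of the chain are CLOSED inequalities and the cell's
`q = 6` budget `ε²e^{-M}/K⁶` lies strictly inside the chain's budget `ε²e^{-M}/(8√M)`, so the chain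
applied to the approximants `Z` with `η → 0` decides `PseudoOrbitTransitionSeed 6`.

* `hasDerivAt_steklov`, `norm_steklov_sub_le` — the Steklov average of a continuous function:
  derivative and distance to the function;
* `norm_sub_sub_smul_le_of_deriv_right` — one-sided mean value estimate of a forward difference
  against a constant velocity;
* `IsPseudoOrbit.exists_smooth_approx` — the smoothing lemma.
-/

namespace Literature.Analysis.FluidPDE.Tao2016AveragedNS

open Set Filter MeasureTheory
open scoped NNReal Topology

/-! ## §1. Steklov averages and a one-sided mean value estimate -/

section Steklov

variable {E : Type*} [NormedAddCommGroup E] [NormedSpace ℝ E]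

/-- **Derivative of the Steklov average.** For continuous `f`, the forward average
`s ↦ h⁻¹ ∫ₛ^{s+h} f` (written with a fixed base point) is differentiable everywhere with derivative
`h⁻¹ (f(s+h) - f s)` (fundamental theorem of calculus). [folklore] -/
theorem hasDerivAt_steklov [CompleteSpace E] {f : ℝ → E} (hf : Continuous f) (h t : ℝ) :
    HasDerivAt (fun s => h⁻¹ • ((∫ x in (0:ℝ)..(s + h), f x) - ∫ x in (0:ℝ)..s, f x))
      (h⁻¹ • (f (t + h) - f t)) t := by
  have h1 : HasDerivAt (fun s => ∫ x in (0:ℝ)..(s + h), f x) (f (t + h)) t :=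
    HasDerivAt.comp_add_const t h (hf.integral_hasStrictDerivAt 0 (t + h)).hasDerivAt
  have h2 : HasDerivAt (fun s => ∫ x in (0:ℝ)..s, f x) (f t) t :=
    (hf.integral_hasStrictDerivAt 0 t).hasDerivAt
  exact (h1.sub h2).fun_const_smul h⁻¹

/-- **The Steklov average is close to the function**: if `‖f x - f t‖ ≤ κ` on `[t, t+h]` (`h > 0`),
then `‖h⁻¹ ∫ₜ^{t+h} f - f t‖ ≤ κ`. [folklore] -/
theorem norm_steklov_sub_le [CompleteSpace E] {f : ℝ → E} (hf : Continuous f) {t h κ : ℝ}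
    (hh : 0 < h)
    (hκ : ∀ x ∈ Icc t (t + h), ‖f x - f t‖ ≤ κ) :
    ‖h⁻¹ • ((∫ x in (0:ℝ)..(t + h), f x) - ∫ x in (0:ℝ)..t, f x) - f t‖ ≤ κ := by
  have hint : ∀ a b : ℝ, IntervalIntegrable f volume a b := fun a b => hf.intervalIntegrable a b
  have hne : h ≠ 0 := hh.ne'
  rw [intervalIntegral.integral_interval_sub_left (hint 0 (t + h)) (hint 0 t)]
  have hI : (∫ x in t..(t + h), (f x - f t)) = (∫ x in t..(t + h), f x) - h • f t := by
    rw [intervalIntegral.integral_sub (hint t (t + h)) intervalIntegrable_const,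
      intervalIntegral.integral_const, add_sub_cancel_left]
  have heq : h⁻¹ • (∫ x in t..(t + h), f x) - f t = h⁻¹ • ∫ x in t..(t + h), (f x - f t) := by
    rw [hI, smul_sub, smul_smul, inv_mul_cancel₀ hne, one_smul]
  rw [heq, norm_smul, Real.norm_eq_abs, abs_inv, abs_of_pos hh]
  have hb : ‖∫ x in t..(t + h), (f x - f t)‖ ≤ κ * |t + h - t| := by
    refine intervalIntegral.norm_integral_le_of_norm_le_const fun x hx => ?_
    rw [uIoc_of_le (by linarith)] at hx
    exact hκ x ⟨hx.1.le, hx.2⟩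
  rw [add_sub_cancel_left, abs_of_pos hh] at hb
  calc h⁻¹ * ‖∫ x in t..(t + h), (f x - f t)‖ ≤ h⁻¹ * (κ * h) :=
        mul_le_mul_of_nonneg_left hb (inv_nonneg.2 hh.le)
    _ = κ := by rw [mul_comm κ h, ← mul_assoc, inv_mul_cancel₀ hne, one_mul]

/-- **One-sided mean value estimate for a forward difference.** If `f` is continuous on `[t, t+h]`
(`h ≥ 0`) with a right derivative `f'` on `[t, t+h)` satisfying `‖f' x - c‖ ≤ C`, then
`‖f(t+h) - f t - h • c‖ ≤ C h` (apply the one-sided mean value inequality to `x ↦ f x - x • c`).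
[folklore] -/
theorem norm_sub_sub_smul_le_of_deriv_right {f f' : ℝ → E} {t h C : ℝ} (c : E) (hh : 0 ≤ h)
    (hf : ContinuousOn f (Icc t (t + h)))
    (hf' : ∀ x ∈ Ico t (t + h), HasDerivWithinAt f (f' x) (Ici x) x)
    (bound : ∀ x ∈ Ico t (t + h), ‖f' x - c‖ ≤ C) :
    ‖f (t + h) - f t - h • c‖ ≤ C * h := by
  have hg : ContinuousOn (fun x => f x - x • c) (Icc t (t + h)) :=
    hf.sub (continuous_id.smul continuous_const).continuousOn
  have hg' : ∀ x ∈ Ico t (t + h),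
      HasDerivWithinAt (fun x => f x - x • c) (f' x - c) (Ici x) x := fun x hx => by
    have h1 : HasDerivWithinAt (fun y : ℝ => y • c) ((1 : ℝ) • c) (Ici x) x :=
      (hasDerivWithinAt_id x (Ici x)).smul_const c
    rw [one_smul] at h1
    exact (hf' x hx).sub h1
  have key := norm_image_sub_le_of_norm_deriv_right_le_segment hg hg' bound (t + h)
    ⟨by linarith, le_rfl⟩
  have heq : f (t + h) - (t + h) • c - (f t - t • c) = f (t + h) - f t - h • c := by
    rw [add_smul]; abel
  rw [heq, add_sub_cancel_left] at key
  exact key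

end Steklov

/-! ## §2. The smoothing lemma -/

variable {m : ℕ}

/-- **Pseudo-orbits are uniform limits of differentiable approximate trajectories.** Let `Y` be a
globally continuous `δ`-pseudo-orbit of the continuous field `F` on `[0,T]` (`T > 0`) with
`‖Y t‖ ≤ R₀` on `[0,T]`. For every `η > 0` there is a trajectory `Z`, differentiable on all of `ℝ`
with velocity `W`, such that `‖W - F(Z)‖ ≤ δ + η` on `[0,T)`, `‖Z‖ ≤ R₀ + η` on `[0,T]` and
`‖Z - Y‖ ≤ η` on `[0,T]` (linear extension past `T` along `F(Y T)`, then a forward Steklov average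
over a short step). [cite: HairerNorsettWanner1993, §I.10] -/
theorem IsPseudoOrbit.exists_smooth_approx {F : (Fin m → ℝ) → (Fin m → ℝ)} (hF : Continuous F)
    {δ : ℝ} {R : ℝ≥0} {T : ℝ} {Y : ℝ → Fin m → ℝ} (h : IsPseudoOrbit F δ R T Y) (hY : Continuous Y)
    (hT : 0 < T) {R₀ : ℝ} (hR₀ : ∀ t ∈ Icc 0 T, ‖Y t‖ ≤ R₀) {η : ℝ} (hη : 0 < η) :
    ∃ Z W : ℝ → Fin m → ℝ, (∀ t, HasDerivAt Z (W t) t) ∧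
      (∀ t ∈ Ico 0 T, ‖W t - F (Z t)‖ ≤ δ + η) ∧ (∀ t ∈ Icc 0 T, ‖Z t‖ ≤ R₀ + η) ∧
      ∀ t ∈ Icc 0 T, ‖Z t - Y t‖ ≤ η := by
  have hδ : 0 ≤ δ := by
    obtain ⟨V, -, hV⟩ := h.defect 0 ⟨le_rfl, hT⟩
    exact (norm_nonneg _).trans hV
  obtain ⟨V, hV⟩ := h.exists_velocity
  -- the linear extension past `T`
  obtain ⟨Yp, hYp⟩ : ∃ Yp : ℝ → Fin m → ℝ,
      Yp = fun t => Y (min t T) + max (t - T) 0 • F (Y T) := ⟨_, rfl⟩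
  have hYp_le : ∀ t, t ≤ T → Yp t = Y t := fun t ht => by
    rw [hYp]; simp [min_eq_left ht, max_eq_right (by linarith : t - T ≤ 0)]
  have hYp_ge : ∀ t, T ≤ t → Yp t = Y T + (t - T) • F (Y T) := fun t ht => by
    rw [hYp]; simp [min_eq_right ht, max_eq_left (by linarith : 0 ≤ t - T)]
  have hYpc : Continuous Yp := by
    have h1 : Continuous fun t => Y (min t T) := hY.comp (continuous_id.min continuous_const)
    rw [hYp]
    exact h1.add (((continuous_id.sub continuous_const).max continuous_const).smul continuous_const)
  -- its right derivative
  obtain ⟨Vp, hVp⟩ : ∃ Vp : ℝ → Fin m → ℝ, Vp = fun t => if t < T then V t else F (Y T) :=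
    ⟨_, rfl⟩
  have hderiv : ∀ s, 0 ≤ s → HasDerivWithinAt Yp (Vp s) (Ici s) s := by
    intro s hs0
    by_cases hsT : s < T
    · have hVps : Vp s = V s := by rw [hVp]; simp [hsT]
      rw [hVps]
      refine (hV s ⟨hs0, hsT⟩).1.congr_of_eventuallyEq ?_ (hYp_le s hsT.le)
      have hmem : Ici s ∩ Iio T ∈ 𝓝[Ici s] s := inter_mem_nhdsWithin (Ici s) (Iio_mem_nhds hsT)
      filter_upwards [hmem] with u hu
      exact hYp_le u hu.2.le
    · rw [not_lt] at hsT
      have hVps : Vp s = F (Y T) := by rw [hVp]; simp [not_lt.2 hsT]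
      rw [hVps]
      have h3 : HasDerivWithinAt (fun u : ℝ => (u - T) • F (Y T)) ((1 : ℝ) • F (Y T)) (Ici s) s :=
        ((hasDerivWithinAt_id s (Ici s)).sub_const T).smul_const (F (Y T))
      rw [one_smul] at h3
      have h2 : HasDerivWithinAt (fun u : ℝ => Y T + (u - T) • F (Y T)) (F (Y T)) (Ici s) s :=
        h3.const_add (Y T)
      refine h2.congr_of_eventuallyEq ?_ (hYp_ge s hsT)
      filter_upwards [self_mem_nhdsWithin] with u hu
      exact hYp_ge u (hsT.trans hu)
  -- a bound for `Yp` on `[0, T+1]`, uniform continuity of `F` on a ball and of `Yp` on `[0, T+1]`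
  obtain ⟨C, hC⟩ : ∃ C, ∀ s ∈ Icc 0 (T + 1), ‖Yp s‖ ≤ C :=
    isCompact_Icc.exists_bound_of_continuousOn hYpc.continuousOn
  have hFuc : UniformContinuousOn F (Metric.closedBall (0 : Fin m → ℝ) (C + 1)) :=
    (isCompact_closedBall _ _).uniformContinuousOn_of_continuous hF.continuousOn
  obtain ⟨ρ, hρ, hFρ⟩ := Metric.uniformContinuousOn_iff.1 hFuc (η / 3) (by positivity)
  obtain ⟨κ, hκ⟩ : ∃ κ : ℝ, κ = min ρ (min η 1) / 2 := ⟨_, rfl⟩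
  have hmin : 0 < min ρ (min η 1) := lt_min hρ (lt_min hη one_pos)
  have hκ0 : 0 < κ := by rw [hκ]; linarith
  have hκρ : κ < ρ := by rw [hκ]; have := min_le_left ρ (min η 1); linarith
  have hκη : κ ≤ η := by
    rw [hκ]; have := (min_le_right ρ (min η 1)).trans (min_le_left η 1); linarith
  have hκ1 : κ ≤ 1 := by
    rw [hκ]; have := (min_le_right ρ (min η 1)).trans (min_le_right η 1); linarith
  have hYuc : UniformContinuousOn Yp (Icc 0 (T + 1)) :=
    isCompact_Icc.uniformContinuousOn_of_continuous hYpc.continuousOn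
  obtain ⟨θ, hθ, hYθ⟩ := Metric.uniformContinuousOn_iff.1 hYuc κ hκ0
  -- the step
  obtain ⟨σ, hσ⟩ : ∃ σ : ℝ, σ = min θ 1 / 2 := ⟨_, rfl⟩
  have hmin' : 0 < min θ 1 := lt_min hθ one_pos
  have hσ0 : 0 < σ := by rw [hσ]; linarith
  have hσθ : σ < θ := by rw [hσ]; have := min_le_left θ 1; linarith
  have hσ1 : σ ≤ 1 := by rw [hσ]; have := min_le_right θ 1; linarith
  -- oscillation of `Yp` over one step
  have hosc : ∀ x ∈ Icc 0 (T + 1), ∀ y ∈ Icc 0 (T + 1), |x - y| ≤ σ → ‖Yp x - Yp y‖ ≤ κ := by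
    intro x hx y hy hxy
    have := hYθ x hx y hy (by rw [Real.dist_eq]; linarith)
    rw [dist_eq_norm] at this
    exact this.le
  -- the right defect of the extension on `[0, T+σ)`
  have hdef : ∀ s ∈ Ico 0 (T + σ), ‖Vp s - F (Yp s)‖ ≤ δ + η / 3 := by
    intro s hs
    by_cases hsT : s < T
    · have hVps : Vp s = V s := by rw [hVp]; simp [hsT]
      rw [hVps, hYp_le s hsT.le]
      linarith [(hV s ⟨hs.1, hsT⟩).2]
    · rw [not_lt] at hsT
      have hVps : Vp s = F (Y T) := by rw [hVp]; simp [not_lt.2 hsT]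
      rw [hVps]
      have hTmem : T ∈ Icc 0 (T + 1) := ⟨hT.le, by linarith⟩
      have hsmem : s ∈ Icc 0 (T + 1) := ⟨hs.1, by linarith [hs.2]⟩
      have hd : dist (Yp T) (Yp s) < ρ := by
        have := hYθ T hTmem s hsmem
          (by rw [Real.dist_eq, abs_of_nonpos (by linarith)]; linarith [hs.2])
        linarith
      have hb1 : Yp T ∈ Metric.closedBall (0 : Fin m → ℝ) (C + 1) := by
        rw [Metric.mem_closedBall, dist_zero_right]; linarith [hC T hTmem]
      have hb2 : Yp s ∈ Metric.closedBall (0 : Fin m → ℝ) (C + 1) := by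
        rw [Metric.mem_closedBall, dist_zero_right]; linarith [hC s hsmem]
      have := hFρ (Yp T) hb1 (Yp s) hb2 hd
      rw [hYp_le T le_rfl, dist_eq_norm] at this
      linarith
  -- the Steklov average
  obtain ⟨Z, hZ⟩ : ∃ Z : ℝ → Fin m → ℝ,
      Z = fun t => σ⁻¹ • ((∫ x in (0:ℝ)..(t + σ), Yp x) - ∫ x in (0:ℝ)..t, Yp x) := ⟨_, rfl⟩
  have hZd : ∀ t, HasDerivAt Z (σ⁻¹ • (Yp (t + σ) - Yp t)) t := by
    rw [hZ]; exact fun t => hasDerivAt_steklov hYpc σ t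
  have hZY : ∀ t ∈ Icc 0 T, ‖Z t - Yp t‖ ≤ κ := by
    intro t ht
    rw [hZ]
    exact norm_steklov_sub_le hYpc hσ0 fun x hx =>
      hosc x ⟨ht.1.trans hx.1, by linarith [hx.2, ht.2]⟩ t ⟨ht.1, by linarith [ht.2]⟩
        (by rw [abs_of_nonneg (by linarith [hx.1])]; linarith [hx.2])
  refine ⟨Z, fun t => σ⁻¹ • (Yp (t + σ) - Yp t), hZd, ?_, ?_, ?_⟩
  · -- defect
    intro t ht
    show ‖σ⁻¹ • (Yp (t + σ) - Yp t) - F (Z t)‖ ≤ δ + η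
    have htT : t ∈ Icc 0 T := ⟨ht.1, ht.2.le⟩
    have htmem : t ∈ Icc 0 (T + 1) := ⟨ht.1, by linarith [ht.2]⟩
    have hYpt : Yp t ∈ Metric.closedBall (0 : Fin m → ℝ) (C + 1) := by
      rw [Metric.mem_closedBall, dist_zero_right]; linarith [hC t htmem]
    -- (i) the forward difference against `F (Yp t)`
    have hmvt : ‖Yp (t + σ) - Yp t - σ • F (Yp t)‖ ≤ (δ + η / 3 + η / 3) * σ := by
      refine norm_sub_sub_smul_le_of_deriv_right (F (Yp t)) hσ0.le hYpc.continuousOn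
        (fun x hx => hderiv x (ht.1.trans hx.1)) fun x hx => ?_
      have hxmem : x ∈ Icc 0 (T + 1) := ⟨ht.1.trans hx.1, by linarith [hx.2, ht.2]⟩
      have h1 : ‖Vp x - F (Yp x)‖ ≤ δ + η / 3 :=
        hdef x ⟨ht.1.trans hx.1, by linarith [hx.2, ht.2]⟩
      have h2 : ‖F (Yp x) - F (Yp t)‖ ≤ η / 3 := by
        have hYpx : Yp x ∈ Metric.closedBall (0 : Fin m → ℝ) (C + 1) := by
          rw [Metric.mem_closedBall, dist_zero_right]; linarith [hC x hxmem]
        have hd : dist (Yp x) (Yp t) < ρ := by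
          have := hYθ x hxmem t htmem
            (by rw [Real.dist_eq, abs_of_nonneg (by linarith [hx.1])]; linarith [hx.2])
          linarith
        have := hFρ (Yp x) hYpx (Yp t) hYpt hd
        rw [dist_eq_norm] at this
        exact this.le
      calc ‖Vp x - F (Yp t)‖ = ‖(Vp x - F (Yp x)) + (F (Yp x) - F (Yp t))‖ := by
            rw [sub_add_sub_cancel]
        _ ≤ ‖Vp x - F (Yp x)‖ + ‖F (Yp x) - F (Yp t)‖ := norm_add_le _ _
        _ ≤ δ + η / 3 + η / 3 := by linarith
    have hq : ‖σ⁻¹ • (Yp (t + σ) - Yp t) - F (Yp t)‖ ≤ δ + η / 3 + η / 3 := by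
      have heq : σ⁻¹ • (Yp (t + σ) - Yp t) - F (Yp t) =
          σ⁻¹ • (Yp (t + σ) - Yp t - σ • F (Yp t)) := by
        rw [smul_sub σ⁻¹ (Yp (t + σ) - Yp t) (σ • F (Yp t)), smul_smul, inv_mul_cancel₀ hσ0.ne',
          one_smul]
      rw [heq, norm_smul, Real.norm_eq_abs, abs_inv, abs_of_pos hσ0]
      calc σ⁻¹ * ‖Yp (t + σ) - Yp t - σ • F (Yp t)‖ ≤ σ⁻¹ * ((δ + η / 3 + η / 3) * σ) :=
            mul_le_mul_of_nonneg_left hmvt (inv_nonneg.2 hσ0.le)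
        _ = δ + η / 3 + η / 3 := by
            rw [mul_comm (δ + η / 3 + η / 3) σ, ← mul_assoc, inv_mul_cancel₀ hσ0.ne', one_mul]
    -- (ii) `F (Yp t)` against `F (Z t)`
    have hFZ : ‖F (Yp t) - F (Z t)‖ ≤ η / 3 := by
      have hZt : Z t ∈ Metric.closedBall (0 : Fin m → ℝ) (C + 1) := by
        rw [Metric.mem_closedBall, dist_zero_right]
        have : ‖Z t‖ ≤ ‖Z t - Yp t‖ + ‖Yp t‖ := by
          calc ‖Z t‖ = ‖(Z t - Yp t) + Yp t‖ := by rw [sub_add_cancel]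
            _ ≤ _ := norm_add_le _ _
        linarith [hZY t htT, hC t htmem]
      have hd : dist (Yp t) (Z t) < ρ := by
        rw [dist_comm, dist_eq_norm]; linarith [hZY t htT]
      have := hFρ (Yp t) hYpt (Z t) hZt hd
      rw [dist_eq_norm] at this
      exact this.le
    calc ‖σ⁻¹ • (Yp (t + σ) - Yp t) - F (Z t)‖
        = ‖(σ⁻¹ • (Yp (t + σ) - Yp t) - F (Yp t)) + (F (Yp t) - F (Z t))‖ := by
          rw [sub_add_sub_cancel]
      _ ≤ ‖σ⁻¹ • (Yp (t + σ) - Yp t) - F (Yp t)‖ + ‖F (Yp t) - F (Z t)‖ := norm_add_le _ _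
      _ ≤ δ + η := by linarith
  · -- norm
    intro t ht
    have h1 := hZY t ht
    rw [hYp_le t ht.2] at h1
    calc ‖Z t‖ = ‖(Z t - Y t) + Y t‖ := by rw [sub_add_cancel]
      _ ≤ ‖Z t - Y t‖ + ‖Y t‖ := norm_add_le _ _
      _ ≤ R₀ + η := by linarith [hR₀ t ht]
  · -- distance to `Y`
    intro t ht
    have h1 := hZY t ht
    rw [hYp_le t ht.2] at h1
    exact h1.trans hκη

end Literature.Analysis.FluidPDE.Tao2016AveragedNS
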